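import Mathlib
import HarnessLib
import Summits.HubbardSuperconductivity.HubbardSuperconductivity.Theorems.KLProgrammePerturbedFermiCurveCooperVolume
import Summits.HubbardSuperconductivity.HubbardSuperconductivity.Theorems.KLProgrammePerturbedFermiCurveCooperRegime

/-!
# Route `KLProgramme` — ENGINE child (stmt-HubbardSuperconductivity-20437 `KLRegimeEngineV17F2`): Lemma E.1 at the Cooper point for the FRAME curve, PACKAGED
# (step (T3a); design note HOME/hubbard-kl-k3c2-p2/TWO-SHELL-FRAME-PORT.md §9)

Cell `gate-hubbard-kl`, seat hubbard-kl-k3c2-p2 g15.  Frame twin of p1b's `klan_exists_cooper_bound`: for a margin `η⋆ > 0` there are `v_C, δ₁, C > 0` depending only on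
the `BandBounds` bundle, the `C⁰/C¹` sizes `κ₀, κ₁ < Dt_min` of the frame shift and the `GeomConstants (frameLevel μ K) Kc r₀ g₀ w` of the frame band — NOT on the
degree of `K` — such that for every admissible level `ν` (margin `η⋆`, `|ν − μ| < r₀`), every `0 < δ ≤ δ₁`, every transfer `0 < |w⃗|_∞ ≤ v_C` and every period
`|{θ ∈ [θ₀, θ₀ + 2π] : |E(p_ν(θ) − w⃗) − ν| ≤ δ}| ≤ C·δ/|w⃗|_∞` (**`exists_cooper_bound_frame`**): the LINEAR law.  Proof: polar form `w⃗ = r·dir ψ`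
(`exists_eq_smul_dir`), separation hypotheses from `lattice_far_of_transfer` / `caustic_far_of_small_transfer`, slope threshold `Λ ∝ |w⃗|_∞`, arc fraction `s`
fixed, and `volume_sublevel_le_cooper_of_geomConstants` when `δ ≤ c₀|w⃗|_∞`; the trivial bound `2π` otherwise.
Everything is PROVED; no definitions, no named facts; nothing asserts any stub or superconductivity.
References: DECOMP App. E Lemma E.1; FST II App. B [cite: FeldmanSalmhoferTrubowitz1998]; BGM 2006 §2.7 [cite: BenfattoGiulianiMastropietro2006].
-/

noncomputable section

namespace Summit.HubbardSuperconductivity.HubbardSuperconductivity.Theorems.PerturbedFermiCurve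

set_option linter.dupNamespace false -- summit = problem name (single-conjunct summit), D-0017

open Real Set MeasureTheory
open scoped ENNReal
open Literature.MathematicalPhysics.QuantumLattice Literature.MathematicalPhysics.QuantumLattice.BandSectorCounting
open Literature.MathematicalPhysics.QuantumLattice.FermiRG
open Summit.HubbardSuperconductivity.HubbardSuperconductivity.Theorems.DispersionFlow
open Summit.HubbardSuperconductivity.HubbardSuperconductivity.Theorems.KLRegimeSplit

/-- The trivial bound: a sublevel set of a period has measure `≤ 2π`. [folklore] -/
theorem volume_sublevel_le_two_pi (S : ℝ → Prop) (θ₀ : ℝ) :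
    volume {θ ∈ Icc θ₀ (θ₀ + 2 * π) | S θ} ≤ ENNReal.ofReal (2 * π) := by
  calc volume {θ ∈ Icc θ₀ (θ₀ + 2 * π) | S θ} ≤ volume (Icc θ₀ (θ₀ + 2 * π)) := measure_mono (fun θ hθ => hθ.1)
    _ = ENNReal.ofReal (2 * π) := by rw [Real.volume_Icc, show θ₀ + 2 * π - θ₀ = 2 * π by ring]

section Frame

variable {a b : ℝ} (B : BandBounds a b) {K : TrigPolyC4v} {κ₀ κ₁ : ℝ}
  (hδ : ∀ k : Fin 2 → ℝ, (∀ i, |k i| ≤ π) → |(fun k : Fin 2 → ℝ => -K.eval k) k| ≤ κ₀)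
  (hκ : ∀ k : Fin 2 → ℝ, (∀ i, |k i| ≤ π) → ‖fderiv ℝ (fun k : Fin 2 → ℝ => -K.eval k) k‖ ≤ κ₁) (hκ₁ : κ₁ < B.Dtmin)
  {μ Kc r₀ g₀ w : ℝ} (hG : GeomConstants (frameLevel μ K) Kc r₀ g₀ w)
include B hδ hκ hκ₁ hG

/-- **Lemma E.1 at the Cooper point for the frame curve, packaged** (see the module docstring). [cite: FeldmanSalmhoferTrubowitz1998, App. B] -/
theorem exists_cooper_bound_frame {ηs : ℝ} (hηs : 0 < ηs) :
    ∃ vC δ₁ C : ℝ, 0 < vC ∧ 0 < δ₁ ∧ 0 < C ∧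
      ∀ ν : ℝ, a + ηs ≤ ν - κ₀ → ν + κ₀ ≤ b - ηs → |ν - μ| < r₀ →
        ∀ (δ : ℝ) (wv : Fin 2 → ℝ) (θ₀ : ℝ), 0 < δ → δ ≤ δ₁ → 0 < max |wv 0| |wv 1| → max |wv 0| |wv 1| ≤ vC →
          volume {θ ∈ Icc θ₀ (θ₀ + 2 * π) |
              |sqDispersion (perturbedFermiRadius (fun k : Fin 2 → ℝ => -K.eval k) ν θ • dir θ - wv) +
                  -K.eval (perturbedFermiRadius (fun k : Fin 2 → ℝ => -K.eval k) ν θ • dir θ - wv) - ν| ≤ δ} ≤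
            ENNReal.ofReal (C * δ / max |wv 0| |wv 1|) := by
  have hπ := Real.pi_pos
  have hsm := B.smax_pos
  have hDt := B.Dtmin_pos
  have hum := B.umin_pos
  have hw := hG.wmin_pos
  have hKc : 0 ≤ Kc := le_trans (norm_nonneg _) (hG.norm_iteratedFDeriv_le (0 : Momentum) 0 (by norm_num))
  have hκ₁0 : 0 ≤ κ₁ := le_trans (norm_nonneg _) (hκ (fun _ => 0) (fun i => by simp [Real.pi_pos.le]))
  have hKb : umklappRadius b < π := umklappRadius_lt_pi B.hb
  -- constants (opaque names with defining equations)
  obtain ⟨D, hD⟩ : ∃ x : ℝ, x = B.Dtmin - κ₁ := ⟨_, rfl⟩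
  have hD0 : 0 < D := by rw [hD]; exact sub_pos.2 hκ₁
  obtain ⟨SE, hSE⟩ : ∃ x : ℝ, x = B.smax + κ₁ * (π * Real.sqrt 2 + 2 * B.smax) / (B.Dtmin - κ₁) := ⟨_, rfl⟩
  have hSE0 : 0 < SE := by rw [hSE, ← hD]; positivity
  obtain ⟨Lm, hLm⟩ : ∃ x : ℝ, x = (4 + κ₁) * (Real.sqrt 2 * SE) / B.umin := ⟨_, rfl⟩
  have hLm0 : 0 < Lm := by rw [hLm]; positivity
  obtain ⟨A1, hA1⟩ : ∃ x : ℝ, x = B.smax * B.Dtmin * (π / 2) * (4 + κ₁) / (D ^ 2 * B.umin ^ 2 * w) := ⟨_, rfl⟩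
  have hA10 : 0 < A1 := by rw [hA1]; positivity
  obtain ⟨Bη, hBη⟩ : ∃ x : ℝ, x = 1 / D + B.smax * B.Dtmin * π * Kc * (4 + κ₁) / (D ^ 3 * B.umin * w) := ⟨_, rfl⟩
  have hBη0 : 0 < Bη := by rw [hBη]; positivity
  -- the radius of the transversality alternative is affine in `(Λ, η)`
  have hRform : ∀ Λ η : ℝ, (η + B.smax * B.Dtmin *
      ((π / 2 * Λ / ((B.Dtmin - κ₁) * B.umin) + π * Kc * η / (B.Dtmin - κ₁) ^ 2) * (4 + κ₁) / (B.umin * w))) / (B.Dtmin - κ₁) =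
      A1 * Λ + Bη * η := by
    intro Λ η
    rw [hA1, hBη, ← hD]
    field_simp
    ring
  -- the arc fraction `s` and the smallness thresholds
  obtain ⟨s, hs⟩ : ∃ x : ℝ, x = min (1 / 2) (1 / (8 * Bη * Lm * Real.sqrt 2 * (π / 2) + 1)) := ⟨_, rfl⟩
  have hs0 : 0 < s := by rw [hs]; exact lt_min (by norm_num) (by positivity)
  have hs1 : s < 1 := by rw [hs]; exact (min_le_left _ _).trans_lt (by norm_num)
  have hsle : s ≤ 1 / (8 * Bη * Lm * Real.sqrt 2 * (π / 2) + 1) := by rw [hs]; exact min_le_right _ _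
  obtain ⟨vC, hvC⟩ : ∃ x : ℝ, x = min (min (min (min (min (s * D / (Real.sqrt 2 * Kc + 1)) (1 / (16 * Bη * Kc + 1)))
      (Real.sqrt 2 * B.umin / 3)) ((2 * π - 2 * umklappRadius b) / 3)) (ηs / (Lm * Real.sqrt 2 * (π / 2) + 2 * Kc + 1))) 1 := ⟨_, rfl⟩
  have hvC0 : 0 < vC := by
    rw [hvC]
    refine lt_min (lt_min (lt_min (lt_min (lt_min (by positivity) (by positivity)) (by positivity)) ?_) (by positivity)) one_pos
    have : 0 < 2 * π - 2 * umklappRadius b := by linarith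
    positivity
  have hv1 : vC ≤ s * D / (Real.sqrt 2 * Kc + 1) := by rw [hvC]; exact le_trans (min_le_left _ _) (le_trans (min_le_left _ _) (le_trans (min_le_left _ _) (le_trans (min_le_left _ _) (min_le_left _ _))))
  have hv2 : vC ≤ 1 / (16 * Bη * Kc + 1) := by rw [hvC]; exact le_trans (min_le_left _ _) (le_trans (min_le_left _ _) (le_trans (min_le_left _ _) (le_trans (min_le_left _ _) (min_le_right _ _))))
  have hv3 : vC ≤ Real.sqrt 2 * B.umin / 3 := by rw [hvC]; exact le_trans (min_le_left _ _) (le_trans (min_le_left _ _) (le_trans (min_le_left _ _) (min_le_right _ _)))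
  have hv4 : vC ≤ (2 * π - 2 * umklappRadius b) / 3 := by rw [hvC]; exact le_trans (min_le_left _ _) (le_trans (min_le_left _ _) (min_le_right _ _))
  have hv5 : vC ≤ ηs / (Lm * Real.sqrt 2 * (π / 2) + 2 * Kc + 1) := by rw [hvC]; exact le_trans (min_le_left _ _) (min_le_right _ _)
  have hv6 : vC ≤ 1 := by rw [hvC]; exact min_le_right _ _
  obtain ⟨c₀, hc₀⟩ : ∃ x : ℝ, x = 1 / (8 * Bη) := ⟨_, rfl⟩
  have hc₀0 : 0 < c₀ := by rw [hc₀]; positivity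
  obtain ⟨C, hC⟩ : ∃ x : ℝ, x = 80 * A1 + 2 * π / c₀ := ⟨_, rfl⟩
  have hC0 : 0 < C := by rw [hC]; positivity
  refine ⟨vC, min ηs 1, C, hvC0, lt_min hηs one_pos, hC0, ?_⟩
  intro ν hνlo hνhi hν δ wv θ₀ hδ0 hδ1 hM0 hMv
  set M := max |wv 0| |wv 1| with hM
  have hδηs : δ ≤ ηs := hδ1.trans (min_le_left _ _)
  -- polar form of the transfer
  obtain ⟨r, ψ, hr0, hwv, hvi, hrle⟩ := exists_eq_smul_dir wv
  have hMr : M ≤ r := max_le (hvi 0) (hvi 1)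
  have hrpos : 0 < r := hM0.trans_le hMr
  have hrM : r ≤ Real.sqrt 2 * M := hrle
  have hrv : r ≤ Real.sqrt 2 * vC := hrM.trans (mul_le_mul_of_nonneg_left hMv (by positivity))
  have h2 : Real.sqrt 2 ≤ 2 := by
    rw [show (2 : ℝ) = Real.sqrt (2 ^ 2) by rw [Real.sqrt_sq (by norm_num : (0:ℝ) ≤ 2)]]
    exact Real.sqrt_le_sqrt (by norm_num)
  have hs2 : 1 < Real.sqrt 2 := by
    rw [show (1 : ℝ) = Real.sqrt 1 by rw [Real.sqrt_one]]
    exact Real.sqrt_lt_sqrt (by norm_num) (by norm_num)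
  by_cases hsmall : δ ≤ c₀ * M
  · -- the Cooper lemma with `Λ = M/(8A₁)`, `R₀ = M/2`
    set Λ := M / (8 * A1) with hΛ
    have hΛ0 : 0 < Λ := by positivity
    set ηA := (4 + κ₁) * (Real.sqrt 2 * (B.smax + κ₁ * (π * Real.sqrt 2 + 2 * B.smax) / (B.Dtmin - κ₁))) / B.umin * (r * (π / 2 * s)) +
      Kc * r ^ 2 with hηA
    have hηA' : ηA = Lm * (r * (π / 2 * s)) + Kc * r ^ 2 := by rw [hηA, hLm, hSE]
    -- `η_A ≤ η⋆` and `B_η η_A ≤ M/4`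
    have hηA0 : 0 ≤ ηA := by rw [hηA']; positivity
    have hηAle : ηA ≤ ηs := by
      rw [hηA']
      have h1 : Lm * (r * (π / 2 * s)) ≤ Lm * Real.sqrt 2 * (π / 2) * vC := by
        have h0 : r * (π / 2 * s) ≤ Real.sqrt 2 * vC * (π / 2 * 1) :=
          mul_le_mul hrv (mul_le_mul_of_nonneg_left hs1.le (by positivity)) (by positivity) (by positivity)
        have := mul_le_mul_of_nonneg_left h0 hLm0.le
        linarith only [this]
      have h2' : Kc * r ^ 2 ≤ 2 * Kc * vC := by
        have hr2 : r ^ 2 ≤ 2 * vC ^ 2 := by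
          have := pow_le_pow_left₀ hr0 hrv 2
          rw [mul_pow, Real.sq_sqrt (by norm_num : (0:ℝ) ≤ 2)] at this; exact this
        have hvv : vC ^ 2 ≤ vC := by
          calc vC ^ 2 = vC * vC := sq vC
            _ ≤ vC * 1 := mul_le_mul_of_nonneg_left hv6 hvC0.le
            _ = vC := mul_one _
        calc Kc * r ^ 2 ≤ Kc * (2 * vC ^ 2) := mul_le_mul_of_nonneg_left hr2 hKc
          _ ≤ Kc * (2 * vC) := mul_le_mul_of_nonneg_left (by linarith only [hvv]) hKc
          _ = 2 * Kc * vC := by ring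
      have h3 : vC * (Lm * Real.sqrt 2 * (π / 2) + 2 * Kc + 1) ≤ ηs := by
        rw [le_div_iff₀ (by positivity)] at hv5; exact hv5
      linarith only [h1, h2', h3, hvC0]
    have hBηA : Bη * ηA ≤ M / 4 := by
      rw [hηA']
      -- `B_η L_m r (π/2) s ≤ M/8` and `B_η Kc r² ≤ M/8`
      have h1 : Bη * (Lm * (r * (π / 2 * s))) ≤ M / 8 := by
        have hs' : s * (8 * Bη * Lm * Real.sqrt 2 * (π / 2) + 1) ≤ 1 := by
          rw [le_div_iff₀ (by positivity)] at hsle; exact hsle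
        have e : Bη * (Lm * (r * (π / 2 * s))) = (Bη * Lm * (π / 2)) * s * r := by ring
        rw [e]
        have h4 : (Bη * Lm * (π / 2)) * s * r ≤ (Bη * Lm * (π / 2)) * s * (Real.sqrt 2 * M) :=
          mul_le_mul_of_nonneg_left hrM (by positivity)
        have h8 : 8 * Bη * Lm * Real.sqrt 2 * (π / 2) * s ≤ 1 := by linarith only [hs', hs0]
        have h9 := mul_le_mul_of_nonneg_left h8 (by positivity : (0:ℝ) ≤ M / 8)
        linarith only [h4, h9]
      have h2' : Bη * (Kc * r ^ 2) ≤ M / 8 := by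
        have hr2 : r ^ 2 ≤ 2 * M ^ 2 := by
          have := pow_le_pow_left₀ hr0 hrM 2
          rw [mul_pow, Real.sq_sqrt (by norm_num : (0:ℝ) ≤ 2)] at this; exact this
        have hMv' : M * (16 * Bη * Kc + 1) ≤ 1 := by
          have := hMv.trans hv2
          rw [le_div_iff₀ (by positivity)] at this; exact this
        have h4 : Bη * (Kc * r ^ 2) ≤ Bη * Kc * (2 * M ^ 2) := by
          rw [← mul_assoc]; exact mul_le_mul_of_nonneg_left hr2 (by positivity)
        have h6 : 16 * Bη * Kc * M ≤ 1 := by linarith only [hMv', hM0]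
        have h7 := mul_le_mul_of_nonneg_left h6 (by positivity : (0:ℝ) ≤ M / 8)
        linarith only [h4, h7]
      linarith only [h1, h2']
    -- admissibility of the levels
    have hκ₀η : a ≤ ν - κ₀ - δ ∧ ν + κ₀ + δ ≤ b := ⟨by linarith only [hνlo, hδηs], by linarith only [hνhi, hδηs]⟩
    have hκ₀A : a ≤ ν - κ₀ - ηA ∧ ν + κ₀ + ηA ≤ b := ⟨by linarith only [hνlo, hηAle], by linarith only [hνhi, hηAle]⟩
    -- `Kc r/D ≤ s`
    have hrs : Kc * r / (B.Dtmin - κ₁) ≤ s := by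
      rw [← hD, div_le_iff₀ hD0]
      have h1 : Kc * r ≤ Kc * (Real.sqrt 2 * vC) := mul_le_mul_of_nonneg_left hrv hKc
      have h3 : vC * (Real.sqrt 2 * Kc + 1) ≤ s * D := by
        rw [le_div_iff₀ (by positivity)] at hv1; exact hv1
      linarith only [h1, h3, hvC0]
    -- separation hypotheses
    have hfar : ∀ m : Fin 2 → ℤ, ∃ i, M / 2 < |(r • dir ψ) i + m i * (2 * π)| := by
      rw [← hwv]
      refine lattice_far_of_transfer (by rw [← hM]; linarith only [hM0]) (fun i => ?_)
      have : |wv i| ≤ M := by fin_cases i <;> simp [hM]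
      have hKb0 := umklappRadius_nonneg b
      linarith only [this, hKb0, hMv.trans hv4, hKb, hM0]
    have hδc : Continuous (fun k : Fin 2 → ℝ => -K.eval k) := (contDiff_frameShift_toLp K (m := 0)).continuous
    have hlo' : a ≤ ν - κ₀ := by linarith only [hνlo, hηs]
    have hhi' : ν + κ₀ ≤ b := by linarith only [hνhi, hηs]
    have hu : ∀ θ, IsBandFermiRadius (ν - (fun k : Fin 2 → ℝ => -K.eval k) (perturbedFermiRadius (fun k : Fin 2 → ℝ => -K.eval k) ν θ • dir θ)) θ
        (perturbedFermiRadius (fun k : Fin 2 → ℝ => -K.eval k) ν θ) := isBandFermiRadius_perturbedFermiRadius B hδc hδ hlo' hhi'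
    have hnc : ∀ (θ : ℝ) (m : Fin 2 → ℤ), ∃ i,
        M / 2 < |2 * (perturbedFermiRadius (fun k : Fin 2 → ℝ => -K.eval k) ν θ • dir θ) i - (r • dir ψ) i - m i * (2 * π)| := by
      intro θ
      rw [← hwv]
      refine caustic_far_of_small_transfer B hδ hlo' hhi' hu (V := M) (fun i => by fin_cases i <;> simp [hM]) ?_ ?_ θ
      · linarith only [hMv.trans hv3, hM0]
      · linarith only [hMv.trans hv4, hM0]
    -- the two radii are `≤ M/2`
    have hRδ : (δ + B.smax * B.Dtmin *
        ((π / 2 * Λ / ((B.Dtmin - κ₁) * B.umin) + π * Kc * δ / (B.Dtmin - κ₁) ^ 2) * (4 + κ₁) / (B.umin * w))) / (B.Dtmin - κ₁) ≤ M / 2 := by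
      rw [hRform]
      have h1 : A1 * Λ = M / 8 := by rw [hΛ]; field_simp
      have h2' : Bη * δ ≤ M / 8 := by
        have := mul_le_mul_of_nonneg_left hsmall hBη0.le
        rw [hc₀] at this
        have e : Bη * (1 / (8 * Bη) * M) = M / 8 := by field_simp
        linarith only [e, this]
      linarith only [h1, h2', hM0]
    have hRA : (ηA + B.smax * B.Dtmin *
        ((π / 2 * Λ / ((B.Dtmin - κ₁) * B.umin) + π * Kc * ηA / (B.Dtmin - κ₁) ^ 2) * (4 + κ₁) / (B.umin * w))) / (B.Dtmin - κ₁) ≤ M / 2 := by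
      rw [hRform]
      have h1 : A1 * Λ = M / 8 := by rw [hΛ]; field_simp
      linarith only [h1, hBηA, hM0]
    have hmain := volume_sublevel_le_cooper_of_geomConstants B hδ hκ hκ₁ hG hν (ψ := ψ) θ₀ hrpos hs0.le hs1 hrs hΛ0
      hκ₀η.1 hκ₀η.2 hκ₀A.1 hκ₀A.2 hfar hnc hRδ hRA
    rw [← hwv] at hmain
    refine hmain.trans ?_
    -- `5·(2δ/Λ) = 80 A₁ δ/M ≤ C δ/M`
    have e : (5 : ℝ≥0∞) * ENNReal.ofReal (2 * δ / Λ) = ENNReal.ofReal (80 * A1 * δ / M) := by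
      rw [show (5 : ℝ≥0∞) = ENNReal.ofReal 5 by simp, ← ENNReal.ofReal_mul (by norm_num)]
      congr 1
      rw [hΛ]; field_simp; ring
    rw [e]
    refine ENNReal.ofReal_le_ofReal ?_
    rw [hC, div_le_div_iff_of_pos_right hM0]
    have : 0 ≤ 2 * π / c₀ * δ := by positivity
    linarith only [this]
  · -- large `δ`: the trivial bound
    push Not at hsmall
    refine (volume_sublevel_le_two_pi _ θ₀).trans (ENNReal.ofReal_le_ofReal ?_)
    rw [le_div_iff₀ hM0, hC]
    have h1 : M < δ / c₀ := by rw [lt_div_iff₀ hc₀0]; linarith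
    have h2' : 2 * π * M ≤ 2 * π / c₀ * δ := by
      have := mul_le_mul_of_nonneg_left h1.le (by positivity : (0:ℝ) ≤ 2 * π)
      calc 2 * π * M ≤ 2 * π * (δ / c₀) := this
        _ = 2 * π / c₀ * δ := by ring
    have h3 : 0 ≤ 80 * A1 * δ := by positivity
    linarith only [h2', h3]

end Frame

end Summit.HubbardSuperconductivity.HubbardSuperconductivity.Theorems.PerturbedFermiCurve

end
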